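import Mathlib
import Summits.PneNP.PneNP.Theorems.ConvexRankGatesLinAlgGateBlindDetCompress
import Summits.PneNP.PneNP.Theses.ConvexRankGates
import Literature.Computability.Complexity.ExtMonotoneCliqueGate
import Literature.Computability.AlgebraicComplexity.DeterminantalComplexity

/-!
# Route ConvexRankGates — crux `LinAlgGateBlind` (stmt-PneNP-10681), support:
# the determinantal normal form of GRANK gates, II — `GRANK_s = DET_s` and the crux read-back

Sequel to `ConvexRankGatesLinAlgGateBlindDetCompress.lean` (base change
`le_rank_symbolicMatrix_map_iff`; generic compression
`le_rank_symbolicMatrix_iff_det_compress_ne_zero`). Here: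

* `exists_det_of_isGRankGate` / `isGRankGate_iff_det` — **normal form**: a gate is a GRANK gate of
  dimension `≤ s` (`IsGRankGate`, `Literature/Computability/Complexity/ExtMonotoneGates.lean`) iff
  it is identically false or it is the DETERMINANT gate `v ↦ [det (K₀ + ∑_{vᵢ=1} Xᵢ Kᵢ) ≠ 0]` of
  an affine symbolic matrix of dimension `≤ s` over some field — the converse of
  `Theorems/LinAlgGateBlind/Negative/DetGate.detGate_isGRankGate`;
* `exists_det_shadow_of_isGRankGate` — hence every GRANK gate is the monotone SHADOW (up-closure
  of the monomial supports) of ONE determinant (`killVars_ne_zero_iff`);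
* `linAlgGateBlind_iff_detBasis` — the crux `Summit.PneNP.PneNP.Theses.ConvexRankGates.LinAlgGateBlind`
  restated VERBATIM with determinant gates in place of GRANK gates (the two gate classes are equal
  as sets of gate functions): its GRANK door is the statement that no affine symbolic matrix of
  polynomial dimension over any field has a determinant whose monotone shadow is
  `CLIQUE(m, ⌈m^δ⌉₊)` — the object studied in `Negative/CliquePolyDetRepr.lean`;
* `le_rank_symbolicMatrix_wiring_iff` / `isGRankGate_rewire` — **absorbing the wiring**: a GRANK
  gate reading wires through repeated argument positions is a GRANK gate of the SAME dimension with
  one position per wire, over `Frac F[a]` (substitute `Xᵢ ↦ aᵢ · Y_{w i}`; injective, commutes with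
  killing variables);
* `exists_hasDetRepr_shadow_of_grankGate_computes` — hence ONE GRANK gate (any wiring) computing
  `CLIQUE(m, k)` yields a polynomial `P` in the edge variables with `HasDetRepr P θ`, `θ ≤ s`, whose
  shadow is `CLIQUE(m, k)`: the exact converse of the disprover's `exists_oneGRankGate_of_shadow`
  — the single-gate GRANK door IS the "kernel" statement on support-constrained determinantal
  complexity in the `k`-clique monomial ideal.

References: J. Edmonds, *Systems of distinct representatives and linear algebra*, J. Res. NBS 71B
(1967) §5 Thm. 1 and §7 [Edmonds1967].
-/

namespace Summit.PneNP.PneNP.Theorems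

open Literature.Computability.Complexity MvPolynomial Matrix

/-! ### The normal form -/

/-- **Determinantal normal form of GRANK gates.** Every GRANK gate of dimension `≤ s` is either
identically false or a DETERMINANT gate: there are a field `F'`, a dimension `θ ≤ s` and data
`K₀', Kᵢ' ∈ F'^{θ×θ}` such that `g` accepts `v` iff `det (K₀' + ∑_{vᵢ=1} Xᵢ Kᵢ') ≠ 0` over
`Frac F'[X]`. (Compression of the rank threshold `θ ≤ rank` by generic `θ × d` and `d × θ`
matrices adjoined to the field; if `θ > d` the gate is constant false.) [folklore] -/
theorem exists_det_of_isGRankGate {s : ℕ} {g : GateFn} (h : IsGRankGate s g) :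
    (∀ v, g.2 v = false) ∨ ∃ (F : Type) (_ : Field F) (θ : ℕ), θ ≤ s ∧
      ∃ (K₀ : Matrix (Fin θ) (Fin θ) F) (K : Fin g.1 → Matrix (Fin θ) (Fin θ) F),
        ∀ v : Fin g.1 → Bool, g.2 v = true ↔ (symbolicMatrix K₀ K v).det ≠ 0 := by
  obtain ⟨F, _, d, θ, hd, K₀, K, hg⟩ := h
  by_cases hθ : θ ≤ d
  · right
    exact ⟨FractionRing (MvPolynomial ((Fin θ × Fin d) ⊕ (Fin d × Fin θ)) F), inferInstance, θ,
      hθ.trans hd, _, _,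
      fun v => (hg v).trans (le_rank_symbolicMatrix_iff_det_compress_ne_zero K₀ K θ v)⟩
  · left
    intro v
    have hlt : ¬ θ ≤ (symbolicMatrix K₀ K v).rank := fun h' =>
      hθ (h'.trans (by simpa using (symbolicMatrix K₀ K v).rank_le_card_width))
    cases hv : g.2 v with
    | false => rfl
    | true => exact absurd ((hg v).1 hv) hlt

/-- A determinant gate of dimension `θ ≤ s` is a GRANK gate (threshold `θ`). [folklore] -/
theorem isGRankGate_of_det {s θ : ℕ} {g : GateFn} (hθ : θ ≤ s) (F : Type) [Field F]
    (K₀ : Matrix (Fin θ) (Fin θ) F) (K : Fin g.1 → Matrix (Fin θ) (Fin θ) F)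
    (hg : ∀ v : Fin g.1 → Bool, g.2 v = true ↔ (symbolicMatrix K₀ K v).det ≠ 0) :
    IsGRankGate s g :=
  ⟨F, inferInstance, θ, θ, hθ, K₀, K, fun v => (hg v).trans
    (Summit.PneNP.PneNP.Theorems.LinAlgGateBlind.Negative.le_rank_iff_det_ne_zero _).symm⟩

/-- The identically-false gate is a GRANK gate of dimension `0` (threshold `1`). [folklore] -/
theorem isGRankGate_of_forall_eq_false {s : ℕ} {g : GateFn} (hg : ∀ v, g.2 v = false) :
    IsGRankGate s g := by
  refine ⟨ℚ, inferInstance, 0, 1, Nat.zero_le _, 0, fun _ => 0, fun v => ?_⟩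
  have h0 : (symbolicMatrix (0 : Matrix (Fin 0) (Fin 0) ℚ) (fun _ : Fin g.1 => 0) v).rank = 0 :=
    le_antisymm (by simpa using (symbolicMatrix (0 : Matrix (Fin 0) (Fin 0) ℚ)
      (fun _ : Fin g.1 => 0) v).rank_le_card_width) (Nat.zero_le _)
  simp [hg v, h0]

/-- **GRANK = DET.** A gate is a GRANK gate of dimension `≤ s` iff it is identically false or a
determinant gate of dimension `≤ s` over some field. [folklore] -/
theorem isGRankGate_iff_det : ∀ {s : ℕ} {g : GateFn},
    IsGRankGate s g ↔ (∀ v, g.2 v = false) ∨ ∃ (F : Type) (_ : Field F) (θ : ℕ), θ ≤ s ∧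
      ∃ (K₀ : Matrix (Fin θ) (Fin θ) F) (K : Fin g.1 → Matrix (Fin θ) (Fin θ) F),
        ∀ v : Fin g.1 → Bool, g.2 v = true ↔ (symbolicMatrix K₀ K v).det ≠ 0 := by
  intro s g
  constructor
  · exact exists_det_of_isGRankGate
  · rintro (h | ⟨F, _, θ, hθ, K₀, K, hg⟩)
    · exact isGRankGate_of_forall_eq_false h
    · exact isGRankGate_of_det hθ F K₀ K hg

/-- **Every GRANK gate is the monotone shadow of ONE determinant.** For a GRANK gate `g` of
dimension `≤ s` that is not identically false there are a field `F'`, `θ ≤ s` and data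
`K₀', Kᵢ' ∈ F'^{θ×θ}` such that `g` accepts `v` iff some monomial of the single polynomial
`det (K₀' + ∑ᵢ Xᵢ Kᵢ') ∈ F'[X]` has all its variables switched on in `v` — the converse of
`Negative/DetGate.detGate_eq_true_iff`. [folklore] -/
theorem exists_det_shadow_of_isGRankGate {s : ℕ} {g : GateFn} (h : IsGRankGate s g) :
    (∀ v, g.2 v = false) ∨ ∃ (F : Type) (_ : Field F) (θ : ℕ), θ ≤ s ∧
      ∃ (K₀ : Matrix (Fin θ) (Fin θ) F) (K : Fin g.1 → Matrix (Fin θ) (Fin θ) F),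
        ∀ v : Fin g.1 → Bool, g.2 v = true ↔
          ∃ m ∈ ((symbolicPolyMatrix K₀ K).det).support, ∀ i ∈ m.support, v i = true := by
  rcases exists_det_of_isGRankGate h with h | ⟨F, _, θ, hθ, K₀, K, hg⟩
  · exact Or.inl h
  · refine Or.inr ⟨F, inferInstance, θ, hθ, K₀, K, fun v => ?_⟩
    rw [hg v, ← Matrix.submatrix_id_id (symbolicMatrix K₀ K v), Ne,
      det_submatrix_symbolicMatrix_eq_zero_iff, Matrix.submatrix_id_id, ← Ne, killVars_ne_zero_iff]

/-! ### The crux with determinant gates in place of GRANK gates -/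

open scoped Classical in
/-- **`LinAlgGateBlind` with the GRANK door in determinantal form.** Replacing, in the crux
`Summit.PneNP.PneNP.Theses.ConvexRankGates.LinAlgGateBlind`, the GRANK gates of dimension `≤ s`
by "identically false, or `det (K₀ + ∑_{vᵢ=1} Xᵢ Kᵢ) ≠ 0` generically for `θ × θ` data over some
field, `θ ≤ s`" does not change the gate class (`isGRankGate_iff_det`), hence not the statement:
the GRANK door of the crux is a statement about monotone shadows of small determinants.
[folklore] -/
theorem linAlgGateBlind_iff_detBasis :
    Summit.PneNP.PneNP.Theses.ConvexRankGates.LinAlgGateBlind ↔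
      ∃ δ : ℝ, 0 < δ ∧ δ < 1 / 2 ∧ ∀ c : ℕ, ∀ᶠ m : ℕ in Filter.atTop,
        ∀ C : Circuit ((⊤ : SimpleGraph (Fin m)).edgeSet),
          C.IsOver ({GateFn.and 2, GateFn.or 2} ∪
            {g | IsPermGate (m ^ c) g ∨ ((∀ v, g.2 v = false) ∨
              ∃ (F : Type) (_ : Field F) (θ : ℕ), θ ≤ m ^ c ∧
                ∃ (K₀ : Matrix (Fin θ) (Fin θ) F) (K : Fin g.1 → Matrix (Fin θ) (Fin θ) F),
                  ∀ v : Fin g.1 → Bool, g.2 v = true ↔ (symbolicMatrix K₀ K v).det ≠ 0)}) →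
          C.size ≤ m ^ c →
            ¬ C.Computes (fun x => decide (¬ (SimpleGraph.fromEdgeSet
              {e : Sym2 (Fin m) | ∃ h : e ∈ (⊤ : SimpleGraph (Fin m)).edgeSet,
                x ⟨e, h⟩ = true}).CliqueFree ⌈(m : ℝ) ^ δ⌉₊)) := by
  have hbasis : ∀ s : ℕ, ({GateFn.and 2, GateFn.or 2} ∪
      {g | IsPermGate s g ∨ ((∀ v, g.2 v = false) ∨
        ∃ (F : Type) (_ : Field F) (θ : ℕ), θ ≤ s ∧
          ∃ (K₀ : Matrix (Fin θ) (Fin θ) F) (K : Fin g.1 → Matrix (Fin θ) (Fin θ) F),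
            ∀ v : Fin g.1 → Bool, g.2 v = true ↔ (symbolicMatrix K₀ K v).det ≠ 0)} : Set GateFn) =
      {GateFn.and 2, GateFn.or 2} ∪ {g | IsPermGate s g ∨ IsGRankGate s g} := by
    intro s
    congr 1
    ext g
    simp only [Set.mem_setOf_eq, isGRankGate_iff_det]
  simp only [hbasis]
  exact Iff.rfl


/-! ### Absorbing the wiring into the field

A GRANK gate of a circuit reads WIRES through its argument positions, several positions possibly
reading the same wire. Generic rank does not see the difference once the field is enlarged: scale
the variable of position `i` by a fresh indeterminate `aᵢ` and rename it to the variable of its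
wire `w i`. The substitution `Xᵢ ↦ aᵢ · Y_{w i}` is an INJECTIVE ring map `F[X] → F'[Y]`,
`F' = Frac F[a]` (evaluate every `Y` at `1` to recover `F[a] ↪ F'`), and it commutes with killing
the unselected variables; so every killed minor survives, in both directions. -/

section Wiring

variable {F : Type*} [Field F] {n N d : ℕ}

/-- The wiring substitution `Xᵢ ↦ aᵢ · Y_{w i}` commutes with killing the unselected variables
(`Y_e` killed iff wire `e` is off; `Xᵢ` killed iff wire `w i` is off). [folklore] -/
theorem wiringSubst_killVars (w : Fin n → Fin N) (x : Fin N → Bool) (p : MvPolynomial (Fin n) F) :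
    MvPolynomial.eval₂Hom
        ((C : FractionRing (MvPolynomial (Fin n) F) →+*
            MvPolynomial (Fin N) (FractionRing (MvPolynomial (Fin n) F))).comp
          ((algebraMap (MvPolynomial (Fin n) F) (FractionRing (MvPolynomial (Fin n) F))).comp
            (C : F →+* MvPolynomial (Fin n) F)))
        (fun i => C (algebraMap (MvPolynomial (Fin n) F) (FractionRing (MvPolynomial (Fin n) F))
          (X i)) * X (w i))
        (killVars (fun i => x (w i)) p) =
      killVars x (MvPolynomial.eval₂Hom
        ((C : FractionRing (MvPolynomial (Fin n) F) →+*
            MvPolynomial (Fin N) (FractionRing (MvPolynomial (Fin n) F))).comp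
          ((algebraMap (MvPolynomial (Fin n) F) (FractionRing (MvPolynomial (Fin n) F))).comp
            (C : F →+* MvPolynomial (Fin n) F)))
        (fun i => C (algebraMap (MvPolynomial (Fin n) F) (FractionRing (MvPolynomial (Fin n) F))
          (X i)) * X (w i)) p) := by
  set ψ := MvPolynomial.eval₂Hom
        ((C : FractionRing (MvPolynomial (Fin n) F) →+*
            MvPolynomial (Fin N) (FractionRing (MvPolynomial (Fin n) F))).comp
          ((algebraMap (MvPolynomial (Fin n) F) (FractionRing (MvPolynomial (Fin n) F))).comp
            (C : F →+* MvPolynomial (Fin n) F)))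
        (fun i => C (algebraMap (MvPolynomial (Fin n) F) (FractionRing (MvPolynomial (Fin n) F))
          (X i)) * X (w i)) with hψ
  have h : ψ.comp (killVars (F := F) (fun i => x (w i)) : MvPolynomial (Fin n) F →+*
      MvPolynomial (Fin n) F) =
      (killVars (F := FractionRing (MvPolynomial (Fin n) F)) x :
        MvPolynomial (Fin N) (FractionRing (MvPolynomial (Fin n) F)) →+*
          MvPolynomial (Fin N) (FractionRing (MvPolynomial (Fin n) F))).comp ψ := by
    refine MvPolynomial.ringHom_ext (fun a => ?_) (fun i => ?_)
    · simp [hψ, killVars]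
    · simp only [RingHom.coe_comp, RingHom.coe_coe, Function.comp_apply, killVars_X, hψ,
        MvPolynomial.eval₂Hom_X', map_mul]
      by_cases hx : x (w i) = true
      · simp [hx, killVars]
      · simp [hx, killVars]
  exact RingHom.congr_fun h p

/-- Evaluating every wire variable at `1` after the wiring substitution recovers the embedding
`F[a] ↪ Frac F[a]`; in particular the wiring substitution is injective. [folklore] -/
theorem wiringSubst_injective (w : Fin n → Fin N) :
    Function.Injective (MvPolynomial.eval₂Hom
        ((C : FractionRing (MvPolynomial (Fin n) F) →+*
            MvPolynomial (Fin N) (FractionRing (MvPolynomial (Fin n) F))).comp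
          ((algebraMap (MvPolynomial (Fin n) F) (FractionRing (MvPolynomial (Fin n) F))).comp
            (C : F →+* MvPolynomial (Fin n) F)))
        (fun i => C (algebraMap (MvPolynomial (Fin n) F) (FractionRing (MvPolynomial (Fin n) F))
          (X i)) * X (w i))) := by
  set j := algebraMap (MvPolynomial (Fin n) F) (FractionRing (MvPolynomial (Fin n) F)) with hj
  set ψ := MvPolynomial.eval₂Hom
        ((C : FractionRing (MvPolynomial (Fin n) F) →+*
            MvPolynomial (Fin N) (FractionRing (MvPolynomial (Fin n) F))).comp
          (j.comp (C : F →+* MvPolynomial (Fin n) F)))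
        (fun i => C (j (X i)) * X (w i)) with hψ
  -- `Λ ∘ ψ = j` where `Λ` evaluates every `Y_e` at `1`
  have hcomp : (MvPolynomial.eval₂Hom (RingHom.id (FractionRing (MvPolynomial (Fin n) F)))
      (fun _ : Fin N => 1)).comp ψ = j := by
    refine MvPolynomial.ringHom_ext (fun a => ?_) (fun i => ?_)
    · simp [hψ]
    · simp [hψ]
  have hinj : Function.Injective ((MvPolynomial.eval₂Hom (RingHom.id
      (FractionRing (MvPolynomial (Fin n) F))) (fun _ : Fin N => 1)).comp ψ) := by
    rw [hcomp]
    exact IsFractionRing.injective (MvPolynomial (Fin n) F) _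
  exact Function.Injective.of_comp (f := (MvPolynomial.eval₂Hom (RingHom.id
      (FractionRing (MvPolynomial (Fin n) F))) (fun _ : Fin N => 1))) hinj

/-- The wiring substitution maps the generic symbolic matrix of the data `K₀, Kᵢ` (positions `i`)
to the generic symbolic matrix, over `F' = Frac F[a]`, of the data `K₀, K'_e = ∑_{w i = e} aᵢ Kᵢ`
(wires `e`). [folklore] -/
theorem symbolicPolyMatrix_map_wiringSubst (w : Fin n → Fin N) (K₀ : Matrix (Fin d) (Fin d) F)
    (K : Fin n → Matrix (Fin d) (Fin d) F) :
    (symbolicPolyMatrix K₀ K).map (MvPolynomial.eval₂Hom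
        ((C : FractionRing (MvPolynomial (Fin n) F) →+*
            MvPolynomial (Fin N) (FractionRing (MvPolynomial (Fin n) F))).comp
          ((algebraMap (MvPolynomial (Fin n) F) (FractionRing (MvPolynomial (Fin n) F))).comp
            (C : F →+* MvPolynomial (Fin n) F)))
        (fun i => C (algebraMap (MvPolynomial (Fin n) F) (FractionRing (MvPolynomial (Fin n) F))
          (X i)) * X (w i))) =
      symbolicPolyMatrix
        (K₀.map ((algebraMap (MvPolynomial (Fin n) F) (FractionRing (MvPolynomial (Fin n) F))).comp
          (C : F →+* MvPolynomial (Fin n) F)))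
        (fun e => ∑ i, (if w i = e then algebraMap (MvPolynomial (Fin n) F)
            (FractionRing (MvPolynomial (Fin n) F)) (X i) else 0) •
          (K i).map ((algebraMap (MvPolynomial (Fin n) F)
            (FractionRing (MvPolynomial (Fin n) F))).comp (C : F →+* MvPolynomial (Fin n) F))) := by
  set j := algebraMap (MvPolynomial (Fin n) F) (FractionRing (MvPolynomial (Fin n) F)) with hj
  refine Matrix.ext fun a b => ?_
  simp only [symbolicPolyMatrix, Matrix.map_apply, Matrix.add_apply, Matrix.sum_apply,
    Matrix.smul_apply, smul_eq_mul, map_add, map_sum, map_mul, MvPolynomial.eval₂Hom_C,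
    MvPolynomial.eval₂Hom_X', RingHom.coe_comp, Function.comp_apply]
  congr 1
  simp only [Finset.mul_sum]
  rw [Finset.sum_comm]
  refine Finset.sum_congr rfl fun i _ => ?_
  rw [Finset.sum_eq_single (w i)]
  · rw [if_pos rfl]
    ring
  · intro e _ hne
    rw [if_neg (Ne.symm hne), map_zero, zero_mul, mul_zero]
  · intro h
    exact absurd (Finset.mem_univ _) h

/-- **Absorbing the wiring.** For GRANK data `K₀, Kᵢ ∈ F^{d×d}` on positions `i < n` wired to wires
`w i < N`: the generic rank threshold at the wired input `x ∘ w` equals the generic rank threshold,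
at `x` itself, of the data `K₀, K'_e = ∑_{w i = e} aᵢ Kᵢ` over `F' = Frac F[a₁, …, aₙ]` — one position
per wire, same dimension. [folklore] -/
theorem le_rank_symbolicMatrix_wiring_iff (w : Fin n → Fin N) (K₀ : Matrix (Fin d) (Fin d) F)
    (K : Fin n → Matrix (Fin d) (Fin d) F) (θ : ℕ) (x : Fin N → Bool) :
    θ ≤ (symbolicMatrix K₀ K (fun i => x (w i))).rank ↔
      θ ≤ (symbolicMatrix
        (K₀.map ((algebraMap (MvPolynomial (Fin n) F) (FractionRing (MvPolynomial (Fin n) F))).comp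
          (C : F →+* MvPolynomial (Fin n) F)))
        (fun e => ∑ i, (if w i = e then algebraMap (MvPolynomial (Fin n) F)
            (FractionRing (MvPolynomial (Fin n) F)) (X i) else 0) •
          (K i).map ((algebraMap (MvPolynomial (Fin n) F)
            (FractionRing (MvPolynomial (Fin n) F))).comp (C : F →+* MvPolynomial (Fin n) F)))
        x).rank := by
  rw [Literature.LinearAlgebra.Matrix.le_rank_iff_exists_det_submatrix_ne_zero,
    Literature.LinearAlgebra.Matrix.le_rank_iff_exists_det_submatrix_ne_zero]
  refine exists_congr fun r => exists_congr fun c => ?_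
  rw [Ne, det_submatrix_symbolicMatrix_eq_zero_iff, Ne, det_submatrix_symbolicMatrix_eq_zero_iff,
    ← symbolicPolyMatrix_map_wiringSubst, Matrix.submatrix_map, ← RingHom.mapMatrix_apply,
    ← RingHom.map_det, ← wiringSubst_killVars, map_eq_zero_iff _ (wiringSubst_injective w)]

end Wiring

/-- **GRANK gates are closed under re-wiring.** If `g` is a GRANK gate of dimension `≤ s` with `n`
positions and `w` wires its positions to `N` wires (repetitions allowed), then the induced gate on
the `N` wires, `x ↦ g (x ∘ w)`, is again a GRANK gate of dimension `≤ s` (over `Frac F[a₁,…,aₙ]`).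
[folklore] -/
theorem isGRankGate_rewire {s : ℕ} {g : GateFn} (hg : IsGRankGate s g) {N : ℕ}
    (w : Fin g.1 → Fin N) : IsGRankGate s ⟨N, fun x => g.2 fun i => x (w i)⟩ := by
  obtain ⟨F, _, d, θ, hd, K₀, K, hg⟩ := hg
  refine ⟨FractionRing (MvPolynomial (Fin g.1) F), inferInstance, d, θ, hd,
    K₀.map ((algebraMap (MvPolynomial (Fin g.1) F) (FractionRing (MvPolynomial (Fin g.1) F))).comp
      (C : F →+* MvPolynomial (Fin g.1) F)),
    fun e => ∑ i, (if w i = e then algebraMap (MvPolynomial (Fin g.1) F)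
        (FractionRing (MvPolynomial (Fin g.1) F)) (X i) else 0) •
      (K i).map ((algebraMap (MvPolynomial (Fin g.1) F)
        (FractionRing (MvPolynomial (Fin g.1) F))).comp (C : F →+* MvPolynomial (Fin g.1) F)),
    fun x => ?_⟩
  exact (hg _).trans (le_rank_symbolicMatrix_wiring_iff w K₀ K θ x)

/-- The entries of the generic symbolic matrix are affine. [folklore] -/
theorem totalDegree_symbolicPolyMatrix_le {F : Type*} [Field F] {n d : ℕ}
    (K₀ : Matrix (Fin d) (Fin d) F) (K : Fin n → Matrix (Fin d) (Fin d) F) (a b : Fin d) :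
    (symbolicPolyMatrix K₀ K a b).totalDegree ≤ 1 := by
  simp only [symbolicPolyMatrix, Matrix.add_apply, Matrix.map_apply, Matrix.sum_apply,
    Matrix.smul_apply, smul_eq_mul]
  refine (totalDegree_add _ _).trans (max_le (by simp) ?_)
  refine (totalDegree_finsetSum _ _).trans (Finset.sup_le fun i _ => ?_)
  refine (totalDegree_mul _ _).trans ?_
  rw [totalDegree_X, totalDegree_C]

/-! ### One GRANK gate computing CLIQUE is a determinant whose shadow is CLIQUE -/

/-- **The single-gate GRANK door is the kernel statement.** If ONE GRANK gate of dimension `≤ s`,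
wired arbitrarily to the edges of `K_m`, computes `CLIQUE(m, k)`, then either `CLIQUE(m, k)` is
identically false (`k > m`) or there are a field `F`, `θ ≤ s` and a polynomial `P` in the edge
variables with an affine determinantal representation of size `θ` (`HasDetRepr P θ`) whose
monotone SHADOW is `CLIQUE(m, k)`: some monomial of `P` has all its edges on in `x` iff `x` spans a
`k`-clique. This is the exact converse of the standing disprover's
`exists_oneGRankGate_of_shadow` (`Cruxes/LinAlgGateBlind/Disproof.lean`, built on
`Negative/DetGate.cktSize_shadow_of_hasDetRepr`): the GRANK half of the single-gate case of the
crux is literally a lower bound for support-constrained determinantal complexity in the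
`k`-clique monomial ideal. [folklore] -/
theorem exists_hasDetRepr_shadow_of_grankGate_computes {m k s : ℕ} {g : GateFn}
    (hg : IsGRankGate s g) (w : Fin g.1 → (⊤ : SimpleGraph (Fin m)).edgeSet)
    (hcomp : ∀ x, g.2 (fun i => x (w i)) = cliqueFn m k x) :
    (∀ x, cliqueFn m k x = false) ∨ ∃ (F : Type) (_ : Field F) (θ : ℕ), θ ≤ s ∧
      ∃ P : MvPolynomial (Fin (CliqueLPGate.nE m)) F,
        Literature.Computability.AlgebraicComplexity.HasDetRepr P θ ∧
        ∀ x : (⊤ : SimpleGraph (Fin m)).edgeSet → Bool,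
          (∃ t ∈ P.support, ∀ i ∈ t.support, x ((CliqueLPGate.eE m).symm i) = true) ↔
            cliqueFn m k x = true := by
  -- the gate re-wired to one position per edge
  have hg' := isGRankGate_rewire hg (fun i => CliqueLPGate.eE m (w i))
  rcases exists_det_shadow_of_isGRankGate hg' with h0 | ⟨F, _, θ, hθ, K₀, K, hK⟩
  · left
    intro x
    have h0' := h0 (fun j => x ((CliqueLPGate.eE m).symm j))
    dsimp only at h0'
    simp only [Equiv.symm_apply_apply] at h0'
    rw [hcomp x] at h0'
    exact h0'
  · right
    refine ⟨F, inferInstance, θ, hθ, (symbolicPolyMatrix K₀ K).det,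
      ⟨symbolicPolyMatrix K₀ K, fun a b => totalDegree_symbolicPolyMatrix_le K₀ K a b, rfl⟩,
      fun x => ?_⟩
    have hK' := hK (fun j => x ((CliqueLPGate.eE m).symm j))
    dsimp only at hK'
    simp only [Equiv.symm_apply_apply] at hK'
    rw [hcomp x] at hK'
    exact hK'.symm

end Summit.PneNP.PneNP.Theorems
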